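import Summits.QuantumFields.BalabanUV.T4Continuum.Support.B13StepEnvelopeEndSub
import Summits.QuantumFields.BalabanUV.T4Continuum.Support.B13StepEnvelopeEndWitness

/-!
# NE5 ∕ U3 — NON-VACUITY OF E9[rec] RE-POINTED OVER A SUB-SLOT (owner RULING R20): the re-pointed Cauchy END
# `B13StepEnvelopeEndSub.ne5_of_record_restrict_envelope_actNormDecay` FIRES on Bałaban's carriers of record for leaf-10's ZERO slot package
# RESTRICTED to a sub-slot `M` of the operator datum (here the full slot `⊤`, typed as the SUBTYPE `↥⊤` — the binders now live on `↥M × Hist`)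

Cell `pub-balaban`, unit `b2b-balaban-t4-ne5-formalise-leaf-03` (NE5 formalisation swarm, LEAF PROVER 03, gen 6; companion of this lineage's
`Support/B13StepEnvelopeEndSub.lean`, in the pattern of `Support/B13StepEnvelopeEndWitness.lean` p214986 (E9[rec]) and leaf-01's
`Support/B13StepOfRecordSecantStructuralWitness.lean` p214898 (E8[rec])).  Summits-side NEW WORK under the LEAN PLACEMENT RULE (cell bookkeeping;
NOT a Literature module; no definition of a hypothesis shape; ONE data def `zeroActDataOn`).  HONEST FRAMING: rung (B)+1 of the FINITE-VOLUME T⁴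
continuum programme — NOT infinite volume, NOT a mass gap, NOT the Clay problem, NOT a proof of NE5: a CONSISTENCY WITNESS for the displayed
binder list of the re-pointed END (the sub-slot ball class, restricted cores, activity data over `↥M`, W1 along the reading) — it says NOTHING
about Bałaban's (2.14) activities, his kernels or insertions; NOT progress on [II]'s objects (c5).  HONEST DEPENDENCY (cell line, verbatim):
continuum YM on T⁴ ⇐ BetaPertH ∧ nine spine estimates (0/9 proved); BetaPertH ⇐ (D1) ∧ (D4) ∧ CAP+tail; G-an2-4 gates asym, D1 and NE2/3/4.

WHAT IS PROVED (kernel; `[folklore]`).  For every `R : TwoRuns 𝔾`, window `W`, `κ ≥ 0`, rate `θ′ ∈ (½, 1]` and EVERY sub-slot `M ≤ OpDatum Unit`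
containing the (zero) operator data of record: §1 the re-typed activity-level binders at zero — `zeroActDataOn` (activity data over ANY operator
carrier), `actExpLinearOn_restrict_zero`, `actOpLineAnalyticOn_restrict_zero`, `actNormBound_restrict_zero` (majorant `A ≡ 0` on the sub-slot class);
§2 **`end_fires_zeroSlots_restrict_envelope`**: `∃ C₅, NE5 (B13StepOfRecord.outA (zeroSlots R) 0 0) (B13StepOfRecord.outB (zeroSlots R) 0 0) W κ θ′ C₅`
THROUGH `ne5_of_record_restrict_envelope_actNormDecay (zeroSlots R) M hA hB` with leaf-10's record-level lemmas BY NAME for the reading, slice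
budgets, levels, W1 entry data and W4 (they are stated on the model of record in the re-pointed END — no transfer needed), §1 for the binders on
`↥M × ℂ`, and the letters of p214986; an `example` instantiates `M := ⊤`.  So the re-pointed binder list is JOINTLY
SATISFIABLE over a sub-slot TYPE (no clash introduced by the re-typing).  0 sorry; axioms ⊆ {propext, Classical.choice, Quot.sound}.
-/

noncomputable section

open scoped BigOperators
open Metric MeasureTheory

namespace Summit.QuantumFields.BalabanUV.T4Continuum.B13StepEnvelopeEndSubWitness

open Literature.MathematicalPhysics.QuantumFieldTheory.Balaban1983to89
open Literature.MathematicalPhysics.QuantumFieldTheory.Balaban1983to89.T4OutputRate (Carriers NE5)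
open Summit.QuantumFields.BalabanUV.T4Continuum.B13Carriers (TwoRuns)
open Summit.QuantumFields.BalabanUV.T4Continuum.B13OpDatum (OpDatum)
open Summit.QuantumFields.BalabanUV.T4Continuum.B13OpDatumJunctions (opOf)
open Summit.QuantumFields.BalabanUV.T4Continuum.B13StepTermLabels (TermIdx InnerLabel)
open Summit.QuantumFields.BalabanUV.T4Continuum.B13StepTermFamily (ActData ActExpLinearOn)
open Summit.QuantumFields.BalabanUV.T4Continuum.B13StepTermSocket (labelsIndexing touchInc)
open Summit.QuantumFields.BalabanUV.T4Continuum.B13InnerData (Bnd b13InnerData)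
open Summit.QuantumFields.BalabanUV.T4Continuum.B13DomainGeometryTR (domainGeometry)
open Summit.QuantumFields.BalabanUV.T4Continuum.B13StepOfRecord (assembly step outA outB)
open Summit.QuantumFields.BalabanUV.T4Continuum.B13StepOfRecordSub (restrict)
open Summit.QuantumFields.BalabanUV.T4Continuum.B13StepEndWitness
  (zeroSlots transportReads_zero sliceBudgetB_zero sliceBudget_zero decayBound_outA_zero decayBound_outB_zero rawBounded_rawAt_zero
  rawBounded_rawB_zero weightedEntrywiseRate_zero floor_zero insertionRate_zero omega_zero)
open Summit.QuantumFields.BalabanUV.T4Continuum.B13StepEnvelopeEndWitness (anchoredNorm_zero)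
open Summit.QuantumFields.BalabanUV.T4Continuum.B13TermOpEnvelope (ActOpLineAnalyticOn)
open Summit.QuantumFields.BalabanUV.T4Continuum.B13StepEnvelopeEndSub (ne5_of_record_restrict_envelope_actNormDecay)

/-! ## §1 The re-typed activity-level binders at zero, over a sub-slot -/

section Binders

variable {C : Carriers} (P J Op : Type*)

/-- [folklore] ZERO ACTIVITY DATA OVER ANY OPERATOR CARRIER `Op` (Dirac measure on `Unit`, weight `0`, functional `0`) — leaf-01's
`zeroActData` with the operator slot generalised (R20). -/
def zeroActDataOn : ActData P J Op ℂ Unit where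
  ν := fun _ _ _ => Measure.dirac ()
  Φ := fun _ _ _ _ => 0
  Λ := fun _ _ _ _ => 0

end Binders

variable {𝔾 : Type} [GaugeGroup 𝔾] (R : TwoRuns 𝔾) (W : Set (ℕ → ℝ))

/-- [folklore] **W2-hist (STRUCTURE) for the zero cores RESTRICTED to the sub-slot**, on ANY class in `↥M × ℂ`: `0 = ∫ 0·e^{0} d(dirac)`. -/
theorem actExpLinearOn_restrict_zero (M : Submodule ℂ (OpDatum Unit))
    (hA : ∀ g V k, opOf (zeroSlots R).F (zeroSlots R).rawA g V k ∈ M) (hB : ∀ g U k, opOf (zeroSlots R).F (zeroSlots R).rawB g U k ∈ M)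
    (K : ℕ → (ℕ → ℝ) → R.carriers.BgB → Set (M × ℂ)) :
    ActExpLinearOn (labelsIndexing (domainGeometry R) (b13InnerData R)) (restrict (zeroSlots R) M hA hB).act
      (zeroActDataOn R.carriers.Dom (InnerLabel R.carriers.Dom (Bnd R)) M) K W where
  sigmaFinite := fun _ _ _ _ _ _ _ _ _ _ _ => by
    show SigmaFinite (Measure.dirac ())
    infer_instance
  integrable := fun _ _ _ _ _ _ _ _ _ _ _ => integrable_zero _ _ _
  measurable := fun _ _ _ _ _ _ _ _ _ _ _ _ => aestronglyMeasurable_const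
  bounded := fun _ _ _ _ _ _ _ _ _ _ _ => ⟨0, Filter.Eventually.of_forall fun _ => by simp [zeroActDataOn]⟩
  repr := fun _ _ _ _ _ _ _ _ _ _ _ => by rw [B13StepOfRecordSub.restrict_act]; simp [zeroActDataOn, zeroSlots]

/-- [folklore] **W2-op AT FACTOR LEVEL for the restricted zero cores on ANY class in `↥M × ℂ`** (directions IN `M`): the constant `0` is
operator-line analytic. -/
theorem actOpLineAnalyticOn_restrict_zero (M : Submodule ℂ (OpDatum Unit))
    (hA : ∀ g V k, opOf (zeroSlots R).F (zeroSlots R).rawA g V k ∈ M) (hB : ∀ g U k, opOf (zeroSlots R).F (zeroSlots R).rawB g U k ∈ M)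
    (K : ℕ → (ℕ → ℝ) → R.carriers.BgB → Set (M × ℂ)) :
    ActOpLineAnalyticOn (labelsIndexing (domainGeometry R) (b13InnerData R)) (restrict (zeroSlots R) M hA hB).act K W :=
  fun _ _ _ _ _ _ _ _ _ _ _ _ _ => by
    show DifferentiableOn ℂ (fun _ : ℂ => (0 : ℂ)) (closedBall 0 1)
    exact differentiableOn_const 0

/-- [folklore] The activity NORM majorant `A ≡ 0` for the restricted zero cores on any class in `↥M × ℂ`. -/
theorem actNormBound_restrict_zero (M : Submodule ℂ (OpDatum Unit)) (K : ℕ → (ℕ → ℝ) → R.carriers.BgB → Set (M × ℂ)) :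
    ∀ k, ∀ g ∈ W, ∀ (U : R.carriers.BgB) (q : M × ℂ), q ∈ K k g U → ∀ X : R.carriers.Dom, R.carriers.scale X = k →
      ∀ i, (labelsIndexing (domainGeometry R) (b13InnerData R)).Rel k i X → ∀ m,
        ‖(zeroSlots R).act ((labelsIndexing (domainGeometry R) (b13InnerData R)).poly i m)
            ((labelsIndexing (domainGeometry R) (b13InnerData R)).lab i m) (q.1 : OpDatum Unit) q.2‖ ≤
          (fun (_ : ℕ) (_ : ℕ → ℝ) (_ : R.carriers.BgB) (_ : R.carriers.Dom) (_ : InnerLabel R.carriers.Dom (Bnd R)) => (0 : ℝ))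
            k g U ((labelsIndexing (domainGeometry R) (b13InnerData R)).poly i m)
            ((labelsIndexing (domainGeometry R) (b13InnerData R)).lab i m) :=
  fun _ _ _ _ _ _ _ _ _ _ _ => by simp [zeroSlots]

/-! ## §2 The re-pointed Cauchy END of record FIRES for the zero package on a sub-slot -/

/-- [folklore] **NON-VACUITY OF E9[rec] RE-POINTED OVER A SUB-SLOT (R20).**  For EVERY pair of runs `R`, window `W`, rate `κ ≥ 0`, prescribed
`θ′ ∈ (½, 1]` and EVERY ℂ-submodule `M ≤ OpDatum Unit` containing the zero package's operator data of record, the hypotheses of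
`B13StepEnvelopeEndSub.ne5_of_record_restrict_envelope_actNormDecay (zeroSlots R) M hA hB` are JOINTLY SATISFIED — reading, slice budgets, levels,
W1 entry data, W4 by leaf-10's record-level lemmas BY NAME; radii `ROp := rOp`, `RHist := bHist 0 0 + rHist`; majorant `A ≡ 0` with decay split
against `A′ ≡ 0`, anchored norm `Φ′ = 0`; **`ActOpLineAnalyticOn` and `ActExpLinearOn` for the RESTRICTED cores over `↥M` (§1)**; numbers
`(E₁, r₀, θ, ρ₀) = (1, 1, ½, ½)`, all other letters `0` — so the END FIRES with root literally on the outputs OF RECORD: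
`∃ C₅, NE5 (outA (zeroSlots R) 0 0) (outB (zeroSlots R) 0 0) W κ θ′ C₅`.  A consistency witness; nothing about [II]'s objects. -/
theorem end_fires_zeroSlots_restrict_envelope (M : Submodule ℂ (OpDatum Unit))
    (hA : ∀ g V k, opOf (zeroSlots R).F (zeroSlots R).rawA g V k ∈ M) (hB : ∀ g U k, opOf (zeroSlots R).F (zeroSlots R).rawB g U k ∈ M)
    {κ θ' : ℝ} (hκ : 0 ≤ κ) (hθ' : 1 / 2 < θ') (hθ'1 : θ' ≤ 1) :
    ∃ C₅, NE5 (outA (zeroSlots R) 0 0) (outB (zeroSlots R) 0 0) W κ θ' C₅ :=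
  ⟨_, ne5_of_record_restrict_envelope_actNormDecay (zeroSlots R) M hA hB 0 0 (ROp := (zeroSlots R).rOp)
    (RHist := fun k => (assembly (zeroSlots R)).bHist 0 0 k + (zeroSlots R).rHist k)
    (A := fun _ _ _ _ _ => 0) (A' := fun _ _ _ _ _ => 0)
    (Dt := zeroActDataOn R.carriers.Dom (InnerLabel R.carriers.Dom (Bnd R)) M) (Φ' := 0) (EA₀ := 0) (E₁ := 1) (cA := 0) (c₁ := 0)
    (r₀ := 1) (δ' := 0) (θ := 1 / 2) (θ' := θ') (ρ₀ := 1 / 2) (B := 0) (k₀ := 0)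
    (transportReads_zero R W) (sliceBudgetB_zero R W κ) (sliceBudget_zero R 0 0 W κ) (decayBound_outA_zero R 0 0 W κ)
    (decayBound_outB_zero R 0 0 W κ) (rawBounded_rawAt_zero R W) (rawBounded_rawB_zero R W)
    (weightedEntrywiseRate_zero R W fun k => (1 / 2 : ℝ) ^ k) (floor_zero R) (insertionRate_zero R 0 0 W κ (1 / 2))
    (fun _ => le_rfl) (fun _ => le_rfl) (actNormBound_restrict_zero R W M _) (fun _ _ _ _ _ => le_rfl) (fun _ _ _ _ _ => le_rfl) hκ
    (fun _ _ _ _ _ => by simp) le_rfl (by norm_num) (anchoredNorm_zero R W) (actOpLineAnalyticOn_restrict_zero R W M hA hB _)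
    (actExpLinearOn_restrict_zero R W M hA hB _) le_rfl one_pos le_rfl le_rfl le_rfl one_pos le_rfl (by norm_num) hθ'.le hθ'1
    (by rw [omega_zero]; norm_num) (by rw [omega_zero]; norm_num) (by norm_num)
    (by rw [omega_zero]; norm_num) le_rfl (fun k hk => absurd hk (Nat.not_lt_zero k))
    (by rw [omega_zero]; norm_num; linarith)⟩

/-- [folklore] **THE FULL SLOT AS A SUB-SLOT TYPE**: the instance `M := ⊤` (membership `Submodule.mem_top`) — the re-pointed END fires with
every binder living on `↥⊤ × ℂ`, root on the outputs of record.  (An `example`, not a declaration: as a bare statement it coincides with this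
lineage's `B13StepEnvelopeEndWitness.end_fires_zeroSlots_envelope` p214986 — the content is the sub-slot-generic theorem above.) -/
example {κ θ' : ℝ} (hκ : 0 ≤ κ) (hθ' : 1 / 2 < θ') (hθ'1 : θ' ≤ 1) :
    ∃ C₅, NE5 (outA (zeroSlots R) 0 0) (outB (zeroSlots R) 0 0) W κ θ' C₅ :=
  end_fires_zeroSlots_restrict_envelope R W ⊤ (fun _ _ _ => Submodule.mem_top) (fun _ _ _ => Submodule.mem_top) hκ hθ' hθ'1

end Summit.QuantumFields.BalabanUV.T4Continuum.B13StepEnvelopeEndSubWitness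

end
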